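import Mathlib
import Summits.Langlands.Langlands.Theorems.CapacityClassicalityHilbertIntegralOverconvergentIsCongruenceAbstractEngineMain
import Summits.Langlands.Langlands.Theorems.CapacityClassicalityHilbertIntegralOverconvergentIsCongruenceAlgebraicMain
import Summits.Langlands.Langlands.Theorems.CapacityClassicalityHilbertIntegralOverconvergentIsCongruenceStubLevelOneIntegralBasis
import Summits.Langlands.Langlands.Theorems.CapacityClassicalityHilbertIntegralOverconvergentIsCongruenceStubUnknownCount
import Summits.Langlands.Langlands.Theorems.CapacityClassicalityHilbertIntegralOverconvergentIsCongruenceStubWeightedNormMul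

/-!
# Crux `HilbertIntegralOverconvergentIsCongruence` (stmt-Langlands-8485), line `Sketch-ideate-r1-k1`:
# the `d = 1` INSTANCE of the abstract engine (registered stub S8 `stub_engineInstanceQ`)

The regression test of RESHAPE 5 of the skeleton
`Cruxes/HilbertIntegralOverconvergentIsCongruence/Lines/Sketch_ideate_r1_k1.lean`: the hypotheses of
the `d`-free vector-weight algebraization engine `stub_abstractEngineMain` (S7) are instantiated in the
classical one-variable case, in the exact vocabulary of the sibling crux
α = `IntegralOverconvergentIsCongruence`:

* variables `σ = Unit` (so `MvPowerSeries Unit R = PowerSeries R`), weight `wt ν = ν ()`, windows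
  `{wt < n}` of size `n`;
* weights `𝓦 = ℤ`, the Sturm family `V b = ι⁻¹ M_b(Γ₁(N))` of `algMain_sturmFamily` with the affine
  Sturm line `L b = ⌊(12 + b) μ / 12⌋`, `μ = [SL₂(ℤ) : Γ₁(N)]`, along the rays `D • 12u + M • (p - 1)`;
* the Hasse lift `e = ι⁻¹ E_{p-1}` of weight `t = p - 1` and α's Katz datum read `p`-adically
  (`algMain_baseDatum`), `ρ = p^{-r}`;
* `g = Σ aₙ qⁿ ∈ 𝓞_E⟦q⟧` (integral lifts of the coefficients), the integral unitriangular bases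
  `E₄^α E₆^β Δ^i` (`stub_levelOneIntegralBasis`) of the level-one spaces of weights `12uD - jk`, their
  archimedean sizes (`stub_weightedNormMul`, `algMain_weighted_pow`, `algMain_summable_qExpansion`) and
  the Siegel count (`stub_unknownCount`, `algMain_counts`);
* the output `Σ_u P_u · f_u · g^{j_u} = 0`, `P ≠ 0`, is turned into the classical non-trivial relation
  `Σ_{j ≤ D} F_j · g^j = 0` over level-one modular forms by `stub_conclude`.

The result is the hypothesis-free theorem `stub_engineInstanceQ`: α's hypotheses imply that `g` is
ALGEBRAIC over the ring of level-one modular forms.  Theorems only, no `sorry`.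
-/

set_option linter.dupNamespace false

noncomputable section

open scoped MatrixGroups NumberField

namespace Summit.Langlands.Langlands.Theorems.HilbertIntegralOverconvergentIsCongruence

/-! ### One variable: `Unit →₀ ℕ` versus `ℕ` -/

/-- The window `{ν : Unit →₀ ℕ | ν () < n}` is finite of size `n` (it is the image of `{0, …, n-1}`
under `Finsupp.single ()`). [folklore] -/
theorem engineQ_window (n : ℕ) :
    {ν : Unit →₀ ℕ | ν () < n}.Finite ∧ {ν : Unit →₀ ℕ | ν () < n}.ncard = n := by
  have hset : {ν : Unit →₀ ℕ | ν () < n} = Finsupp.single () '' (↑(Finset.range n) : Set ℕ) := by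
    ext ν
    simp only [Set.mem_setOf_eq, Set.mem_image, Finset.coe_range, Set.mem_Iio]
    constructor
    · intro h
      exact ⟨ν (), h, (Finsupp.unique_single ν).symm⟩
    · rintro ⟨m, hm, rfl⟩
      rwa [Finsupp.single_eq_same]
  rw [hset]
  refine ⟨(Finset.finite_toSet _).image _, ?_⟩
  rw [Set.ncard_image_of_injective _ (Finsupp.single_injective ()), Set.ncard_coe_finset,
    Finset.card_range]

/-- Transport of weighted `ℓ¹` sizes from `ℕ` to `Unit →₀ ℕ` along `ν ↦ ν ()`. [folklore] -/
theorem engineQ_transport (F : ℕ → ℝ) (hF : Summable F) :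
    Summable (fun ν : Unit →₀ ℕ ↦ F (ν ())) ∧ ∑' ν : Unit →₀ ℕ, F (ν ()) = ∑' m : ℕ, F m := by
  let eqv : (Unit →₀ ℕ) ≃ ℕ :=
    { toFun := fun ν ↦ ν ()
      invFun := fun m ↦ Finsupp.single () m
      left_inv := fun ν ↦ (Finsupp.unique_single ν).symm
      right_inv := fun m ↦ Finsupp.single_eq_same }
  exact ⟨eqv.summable_iff.mpr hF, eqv.tsum_eq F⟩

/-- The affine Sturm line along the rays `D • w + M • t`:
`⌊(12 + Dw + Mt) μ / 12⌋ ≤ (wμ/12) D + (tμ/12) M + μ`. [folklore] -/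
theorem engineQ_line (μ w t D M : ℕ) :
    ((((12 + ((D • (w : ℤ)) + M • (t : ℤ))) * (μ : ℤ)).toNat / 12 : ℕ) : ℝ) ≤
      (w : ℝ) * μ / 12 * D + (t : ℝ) * μ / 12 * M + μ := by
  have h1 : (((12 + ((D • (w : ℤ)) + M • (t : ℤ))) * (μ : ℤ)).toNat : ℤ) =
      (12 + ((D * w) + M * t)) * μ := by
    rw [nsmul_eq_mul, nsmul_eq_mul]
    exact Int.toNat_of_nonneg (by positivity)
  have h2 : (((12 + ((D • (w : ℤ)) + M • (t : ℤ))) * (μ : ℤ)).toNat : ℝ) =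
      (12 + ((D * w) + M * t)) * μ := by exact_mod_cast h1
  calc ((((12 + ((D • (w : ℤ)) + M • (t : ℤ))) * (μ : ℤ)).toNat / 12 : ℕ) : ℝ)
      ≤ (((12 + ((D • (w : ℤ)) + M • (t : ℤ))) * (μ : ℤ)).toNat : ℝ) / 12 := Nat.cast_div_le
    _ = (12 + ((D * w) + M * t)) * μ / 12 := by rw [h2]
    _ = (w : ℝ) * μ / 12 * D + (t : ℝ) * μ / 12 * M + μ := by ring

/-! ### Archimedean sizes of the basis `E₄^α E₆^β Δ^i` -/

/-- At `0 < t₀ < 1`: if the weighted `ℓ¹` sizes of the `q`-expansions of `E₄`, `E₆`, `Δ` are `≤ B₀`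
(`B₀ ≥ 1`) then the size of `E₄^α E₆^β Δ^i` is `≤ B₀^{N₁}` whenever `α + β + i ≤ N₁` (the product rule
`stub_weightedNormMul`, iterated). [folklore] -/
theorem engineQ_arch (t₀ : ℝ) (ht₀0 : 0 < t₀) (ht₀1 : t₀ < 1) (B₀ : ℝ) (hB₀1 : 1 ≤ B₀)
    (hW₄ : ∑' n : ℕ, ‖PowerSeries.coeff n (UpperHalfPlane.qExpansion 1 ⇑ModularForm.E₄)‖ * t₀ ^ n ≤ B₀)
    (hW₆ : ∑' n : ℕ, ‖PowerSeries.coeff n (UpperHalfPlane.qExpansion 1 ⇑ModularForm.E₆)‖ * t₀ ^ n ≤ B₀)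
    (hWΔ : ∑' n : ℕ, ‖PowerSeries.coeff n (UpperHalfPlane.qExpansion 1 ⇑CuspForm.discriminant)‖ * t₀ ^ n ≤ B₀)
    (α β i N₁ : ℕ) (hαβi : α + β + i ≤ N₁) :
    ∑' n : ℕ, ‖PowerSeries.coeff n (UpperHalfPlane.qExpansion 1 ⇑ModularForm.E₄ ^ α *
        UpperHalfPlane.qExpansion 1 ⇑ModularForm.E₆ ^ β *
        UpperHalfPlane.qExpansion 1 ⇑CuspForm.discriminant ^ i)‖ * t₀ ^ n ≤ B₀ ^ N₁ := by
  -- products of finite weighted sizes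
  have hWmul : ∀ (φ ψ : PowerSeries ℂ) (X Y : ℝ), 0 ≤ X →
      (Summable fun n : ℕ ↦ ‖PowerSeries.coeff n φ‖ * t₀ ^ n) →
      (∑' n : ℕ, ‖PowerSeries.coeff n φ‖ * t₀ ^ n) ≤ X →
      (Summable fun n : ℕ ↦ ‖PowerSeries.coeff n ψ‖ * t₀ ^ n) →
      (∑' n : ℕ, ‖PowerSeries.coeff n ψ‖ * t₀ ^ n) ≤ Y →
      (Summable fun n : ℕ ↦ ‖PowerSeries.coeff n (φ * ψ)‖ * t₀ ^ n) ∧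
        (∑' n : ℕ, ‖PowerSeries.coeff n (φ * ψ)‖ * t₀ ^ n) ≤ X * Y := by
    intro φ ψ X Y hX hφ hφX hψ hψY
    obtain ⟨hs, hle⟩ := stub_weightedNormMul φ ψ t₀ ht₀0.le hφ hψ
    refine ⟨hs, hle.trans ?_⟩
    have h0 : 0 ≤ ∑' n : ℕ, ‖PowerSeries.coeff n ψ‖ * t₀ ^ n := tsum_nonneg fun n ↦ by positivity
    exact mul_le_mul hφX hψY h0 hX
  -- powers of finite weighted sizes
  have hWpow : ∀ (φ : PowerSeries ℂ) (X : ℝ) (m : ℕ), 0 ≤ X →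
      (Summable fun n : ℕ ↦ ‖PowerSeries.coeff n φ‖ * t₀ ^ n) →
      (∑' n : ℕ, ‖PowerSeries.coeff n φ‖ * t₀ ^ n) ≤ X →
      (Summable fun n : ℕ ↦ ‖PowerSeries.coeff n (φ ^ m)‖ * t₀ ^ n) ∧
        (∑' n : ℕ, ‖PowerSeries.coeff n (φ ^ m)‖ * t₀ ^ n) ≤ X ^ m := by
    intro φ X m hX hφ hφX
    obtain ⟨hs, hle⟩ := algMain_weighted_pow stub_weightedNormMul φ t₀ ht₀0.le hφ m
    exact ⟨hs, hle.trans (pow_le_pow_left₀ (tsum_nonneg fun n ↦ by positivity) hφX m)⟩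
  have hs₄ := algMain_summable_qExpansion ModularForm.E₄ t₀ ht₀0.le ht₀1
  have hs₆ := algMain_summable_qExpansion ModularForm.E₆ t₀ ht₀0.le ht₀1
  have hsΔ := algMain_summable_qExpansion (CuspForm.discriminant : ModularForm 𝒮ℒ 12) t₀ ht₀0.le ht₀1
  have hB₀0 : 0 ≤ B₀ := zero_le_one.trans hB₀1
  obtain ⟨hp₄, hle₄⟩ := hWpow _ B₀ α hB₀0 hs₄ hW₄
  obtain ⟨hp₆, hle₆⟩ := hWpow _ B₀ β hB₀0 hs₆ hW₆
  obtain ⟨hpΔ, hleΔ⟩ := hWpow _ B₀ i hB₀0 hsΔ hWΔ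
  obtain ⟨hs₁, hle₁⟩ := hWmul _ _ _ _ (pow_nonneg hB₀0 _) hp₄ hle₄ hp₆ hle₆
  obtain ⟨-, hle₂⟩ := hWmul _ _ _ _ (mul_nonneg (pow_nonneg hB₀0 _) (pow_nonneg hB₀0 _)) hs₁ hle₁ hpΔ hleΔ
  refine hle₂.trans ?_
  calc B₀ ^ α * B₀ ^ β * B₀ ^ i = B₀ ^ (α + β + i) := by rw [pow_add, pow_add]
    _ ≤ B₀ ^ N₁ := pow_le_pow_right₀ hB₀1 hαβi

/-! ### The `d = 1` instance (registered stub S8) -/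

/-- **Registered stub S8 (`stub_engineInstanceQ`) of line `Sketch-ideate-r1-k1`: the `d = 1`
regression instance of the engine, hypothesis-free.**  α's hypotheses (`p ≥ 5`, `p ∤ N`,
`𝓞_E`-integral coefficients, radius `≥ 1` under every complex embedding, `p`-adic Katz datum of rate
`r > 0` on `Γ₁(N)` along `ι`) imply that `g = Σ σ₀(aₙ) qⁿ` is ALGEBRAIC over the ring of level-one
modular forms: `Σ_{j ≤ D} F_j(q) g(q)^j = 0` with `F_j ∈ M_{b_j}(SL₂(ℤ))`, `b_j + jk = b_0`, not all
zero.  Proof: the abstract engine `stub_abstractEngineMain` at `σ = Unit`, `wt = ν ↦ ν ()`, `𝓦 = ℤ`,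
`V` the Sturm family `algMain_sturmFamily`, `L b = ⌊(12 + b) μ / 12⌋`, `e = ι⁻¹ E_{p-1}`, `t = p - 1`,
the datum `algMain_baseDatum`, `w₀ = 12u`, the bases `E₄^α E₆^β Δ^i` over `J(12uD - jk)`
(`stub_levelOneIntegralBasis`) with sizes from `stub_weightedNormMul` and counts from
`stub_unknownCount`/`algMain_counts`, and the conclusion through `stub_conclude`. [folklore] -/
theorem stub_engineInstanceQ :
    ∀ (p : ℕ) [Fact p.Prime] (hp : 5 ≤ p) (N : ℕ) [NeZero N], ¬ p ∣ N →
      ∀ (k : ℤ) (ι : PadicAlgCl p ≃+* ℂ) (E : Type) [Field E] [NumberField E] (σ₀ : E →+* ℂ)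
        (a : ℕ → E), (∀ n, IsIntegral ℤ (a n)) →
      (∀ (σ : E →+* ℂ) (t : ℝ), 0 < t → t < 1 → ∃ C : ℝ, ∀ n, ‖σ (a n)‖ * t ^ n ≤ C) →
      (∃ (r C : ℝ) (c : ℕ → PowerSeries ℂ), 0 < r ∧
        (∀ i : ℕ, ∃ F : ModularForm (CongruenceSubgroup.Gamma1 N) (k + i * (p - 1 : ℕ)),
          c i = UpperHalfPlane.qExpansion 1 ⇑F) ∧
        (∀ i n : ℕ, ‖ι.symm (PowerSeries.coeff n (c i))‖ ≤ C * (p : ℝ) ^ (-(r * i))) ∧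
        ∀ n : ℕ, HasSum (fun i : ℕ ↦ ι.symm (PowerSeries.coeff n (c i *
          ((UpperHalfPlane.qExpansion 1 ⇑(ModularForm.E (show 3 ≤ p - 1 by omega)))⁻¹) ^ i)))
          (ι.symm (σ₀ (a n)))) →
      ∃ (D : ℕ) (b : ℕ → ℤ) (F : (j : ℕ) → ModularForm 𝒮ℒ (b j)),
        (∃ j ≤ D, F j ≠ 0) ∧ (∀ j, b j + j * k = b 0) ∧
        ∑ j ∈ Finset.range (D + 1),
          UpperHalfPlane.qExpansion 1 ⇑(F j) * (PowerSeries.mk fun n ↦ σ₀ (a n)) ^ j = 0 := by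
  intro p _ hp N _ hpN k ι E _ _ σ₀ a hint harch hkatz
  obtain ⟨r, C, c, hr, hc, hbound, hsum⟩ := hkatz
  classical
  /- ### 1. Constants, the Sturm family, the base datum -/
  obtain ⟨u, hu_def⟩ : ∃ u : ℕ, u = k.natAbs + 1 := ⟨_, rfl⟩
  obtain ⟨μ, hμ_def⟩ : ∃ μ : ℕ, μ = (CongruenceSubgroup.Gamma1 N).index := ⟨_, rfl⟩
  have hμ1 : 1 ≤ μ := by
    rw [hμ_def]; exact Nat.one_le_iff_ne_zero.mpr Subgroup.FiniteIndex.index_ne_zero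
  obtain ⟨V, hVdef, hV1, hV0, hVadd, hVsmul, hVmul, -, heV, hSturmV⟩ := algMain_sturmFamily p hp N hpN ι
  rw [← hμ_def] at hSturmV
  obtain ⟨he0, heint, hρ0, hρ1, haK, hGK⟩ :=
    algMain_baseDatum p hp ι r C c hr hbound (fun n ↦ ι.symm (σ₀ (a n))) hsum
  have hC0 : (0 : ℝ) ≤ max 1 C := zero_le_one.trans (le_max_left _ _)
  have haKV : ∀ i : ℕ, (PowerSeries.map ι.symm.toRingHom (c i) : MvPowerSeries Unit (PadicAlgCl p)) ∈
      V (k + i • ((p - 1 : ℕ) : ℤ)) := by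
    intro i
    rw [nsmul_eq_mul, hVdef]
    obtain ⟨F, hF⟩ := hc i
    exact ⟨F, by rw [hF]⟩
  have hct : (0 : ℝ) < ((p - 1 : ℕ) : ℝ) * μ / 12 := by
    have h4 : (0 : ℝ) < ((p - 1 : ℕ) : ℝ) := by exact_mod_cast (show 0 < p - 1 by omega)
    have hμ0 : (0 : ℝ) < μ := by exact_mod_cast hμ1
    positivity
  /- ### 2. The unknowns: weights, index sets, the basis, thresholds -/
  obtain ⟨J, hJ_def⟩ : ∃ J : ℕ → Finset ℕ, ∀ b, J b = if Even b then
      (Finset.range (b / 12 + 1)).filter (fun i ↦ b - 12 * i ≠ 2) else ∅ := ⟨_, fun b ↦ rfl⟩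
  obtain ⟨bw, hbw_def⟩ : ∃ bw : ℕ → ℕ → ℕ, ∀ D jj, bw D jj = (((12 * u * D : ℕ) : ℤ) - jj * k).toNat :=
    ⟨_, fun D jj ↦ rfl⟩
  obtain ⟨hJmem, hbw_cast, hbw_le, hβpos, hcardQ, hgrow⟩ := algMain_counts k u hu_def J hJ_def bw hbw_def
    (stub_unknownCount k u hu_def J hJ_def _ (fun D ↦ rfl))
    (fun D ↦ ∑ jj ∈ Finset.range D, (J (bw D jj)).card) (fun D ↦ rfl)
  have hbasis : ∀ b i, i ∈ J b → ∃ (α β : ℕ) (F : ModularForm 𝒮ℒ (b : ℤ)) (P : PowerSeries ℤ),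
      4 * α + 6 * β + 12 * i = b ∧
      UpperHalfPlane.qExpansion 1 ⇑F =
        UpperHalfPlane.qExpansion 1 ⇑ModularForm.E₄ ^ α * UpperHalfPlane.qExpansion 1 ⇑ModularForm.E₆ ^ β *
          UpperHalfPlane.qExpansion 1 ⇑CuspForm.discriminant ^ i ∧
      UpperHalfPlane.qExpansion 1 ⇑F = P.map (Int.castRingHom ℂ) ∧
      (∀ n < i, PowerSeries.coeff n P = 0) ∧ PowerSeries.coeff i P = 1 :=
    fun b i hi ↦ stub_levelOneIntegralBasis b i (hJmem b i hi).1 (hJmem b i hi).2.1 (hJmem b i hi).2.2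
  choose αf βf Ff Pf hαβ hFprod hFP hPlt hPi using hbasis
  have hcardI : ∀ D, ∑ j ∈ Finset.range D, Fintype.card ↥(J (bw D j)) =
      ∑ jj ∈ Finset.range D, (J (bw D jj)).card :=
    fun D ↦ Finset.sum_congr rfl fun j _ ↦ Fintype.card_coe _
  obtain ⟨N₀, hN₀_def⟩ : ∃ N₀ : ℕ → ℕ, ∀ D, N₀ D = (∑ jj ∈ Finset.range D, (J (bw D jj)).card - 1) / 2 :=
    ⟨_, fun D ↦ rfl⟩
  have hfin : ∀ n : ℕ, {ν : Unit →₀ ℕ | Finsupp.applyAddHom (M := ℕ) () ν < n}.Finite :=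
    fun n ↦ (engineQ_window n).1
  have hcount : ∀ D, 1 ≤ D → 2 * {ν : Unit →₀ ℕ | ν () < N₀ D}.ncard <
      ∑ j ∈ Finset.range D, Fintype.card ↥(J (bw D j)) := by
    intro D hD
    rw [(engineQ_window (N₀ D)).2, hcardI, hN₀_def]
    have := hβpos D hD
    omega
  have hgrowth : ∀ m : ℕ, ∃ D : ℕ, 1 ≤ D ∧ m * D ≤ N₀ D := by
    intro m
    obtain ⟨D, hD, hmD⟩ := hgrow m
    exact ⟨D, hD, by rw [hN₀_def]; exact hmD⟩
  have hQ : ∀ D, 1 ≤ D →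
      ((∑ j ∈ Finset.range D, Fintype.card ↥(J (bw D j)) : ℕ) : ℝ) ≤ (24 * u : ℝ) ^ D := by
    intro D hD
    rw [hcardI]
    exact hcardQ D hD
  /- ### 3. The coefficients: integral lifts, `q`-expansion bookkeeping -/
  have ha'ex : ∀ n, ∃ y : 𝓞 E, algebraMap (𝓞 E) E y = a n := fun n ↦
    (IsIntegralClosure.isIntegral_iff (A := 𝓞 E)).mp (hint n)
  choose a' ha' using ha'ex
  obtain ⟨g, hg_def⟩ : ∃ g : MvPowerSeries Unit (𝓞 E), g = PowerSeries.mk a' := ⟨_, rfl⟩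
  have hgcoeff : ∀ ν : Unit →₀ ℕ, algebraMap (𝓞 E) E (MvPowerSeries.coeff ν g) = a (ν ()) := by
    intro ν
    obtain ⟨m, rfl⟩ : ∃ m : ℕ, ν = Finsupp.single () m := ⟨ν (), Finsupp.unique_single ν⟩
    rw [hg_def, PowerSeries.coeff_coeToMvPowerSeries, PowerSeries.coeff_mk, Finsupp.single_eq_same, ha']
  have hgmap : ∀ {S : Type} [CommRing S] (φ : E →+* S) (ψ : ℕ → S), (∀ n, φ (a n) = ψ n) →
      MvPowerSeries.map (σ := Unit) (φ.comp (algebraMap (𝓞 E) E)) g = PowerSeries.mk ψ := by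
    intro S _ φ ψ hψ
    refine PowerSeries.ext fun m ↦ ?_
    change PowerSeries.coeff m (PowerSeries.map (φ.comp (algebraMap (𝓞 E) E)) g) = _
    rw [hg_def, PowerSeries.coeff_map, PowerSeries.coeff_mk, PowerSeries.coeff_mk, RingHom.comp_apply,
      ha', hψ]
  have hPfmap : ∀ {S : Type} [CommRing S] (φ : 𝓞 E →+* S) (P : PowerSeries ℤ),
      MvPowerSeries.map (σ := Unit) φ (PowerSeries.map (Int.castRingHom (𝓞 E)) P) =
        PowerSeries.map (Int.castRingHom S) P := by
    intro S _ φ P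
    refine PowerSeries.ext fun m ↦ ?_
    change PowerSeries.coeff m (PowerSeries.map φ (PowerSeries.map (Int.castRingHom (𝓞 E)) P)) = _
    rw [PowerSeries.coeff_map, PowerSeries.coeff_map, PowerSeries.coeff_map, eq_intCast, eq_intCast,
      map_intCast]
  have hmapZ : ∀ P : PowerSeries ℤ,
      PowerSeries.map ι.symm.toRingHom (PowerSeries.map (Int.castRingHom ℂ) P) =
        PowerSeries.map (Int.castRingHom (PadicAlgCl p)) P := by
    intro P
    refine PowerSeries.ext fun m ↦ ?_
    simp only [PowerSeries.coeff_map, eq_intCast, map_intCast]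
  have hfcoeff : ∀ (b ii : ℕ) (h : ii ∈ J b) (τ : E →+* ℂ) (ν : Unit →₀ ℕ),
      τ (algebraMap (𝓞 E) E (MvPowerSeries.coeff ν
        (PowerSeries.map (Int.castRingHom (𝓞 E)) (Pf b ii h) : MvPowerSeries Unit (𝓞 E)))) =
      PowerSeries.coeff (ν ()) (UpperHalfPlane.qExpansion 1 ⇑(Ff b ii h)) := by
    intro b ii h τ ν
    obtain ⟨m, rfl⟩ : ∃ m : ℕ, ν = Finsupp.single () m := ⟨ν (), Finsupp.unique_single ν⟩
    rw [PowerSeries.coeff_coeToMvPowerSeries, PowerSeries.coeff_map, Finsupp.single_eq_same, hFP,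
      PowerSeries.coeff_map, eq_intCast, eq_intCast, map_intCast, map_intCast]
  /- ### 4. The `p`-adic side: `v = ι⁻¹ ∘ σ₀`, the Katz sum, the bases inside the Sturm family -/
  obtain ⟨v, hv⟩ : ∃ v : E →+* PadicAlgCl p, ∀ x, v x = ι.symm (σ₀ x) :=
    ⟨ι.symm.toRingHom.comp σ₀, fun x ↦ rfl⟩
  have hgK : MvPowerSeries.map (σ := Unit) (v.comp (algebraMap (𝓞 E) E)) g =
      PowerSeries.mk fun n ↦ ι.symm (σ₀ (a n)) := hgmap v _ fun n ↦ hv _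
  have hfV : ∀ (D j : ℕ) (i : ↥(J (bw D j))), j < D →
      MvPowerSeries.map (v.comp (algebraMap (𝓞 E) E))
        (PowerSeries.map (Int.castRingHom (𝓞 E)) (Pf (bw D j) i.1 i.2) : MvPowerSeries Unit (𝓞 E)) ∈
        V (D • ((12 * u : ℕ) : ℤ) - j • k) := by
    intro D j i hjD
    have hw : ((bw D j : ℕ) : ℤ) = D • ((12 * u : ℕ) : ℤ) - j • k := by
      rw [hbw_cast D j hjD.le, nsmul_eq_mul, nsmul_eq_mul]; push_cast; ring
    obtain ⟨F', hF'⟩ := algMain_restrict N (ModularForm.mcast hw (Ff (bw D j) i.1 i.2))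
    rw [hVdef, hPfmap]
    refine ⟨F', ?_⟩
    rw [hF', ModularForm.qExpansion_mcast, hFP, hmapZ]
  /- ### 5. Archimedean sizes -/
  have harch' : ∀ η : ℝ, 0 < η → ∃ B : ℝ, 1 ≤ B ∧
      (∀ τ : E →+* ℂ,
        Summable (fun n : Unit →₀ ℕ ↦ ‖τ (algebraMap (𝓞 E) E (MvPowerSeries.coeff n g))‖ *
          Real.exp (-η) ^ Finsupp.applyAddHom (M := ℕ) () n) ∧
        ∑' n : Unit →₀ ℕ, ‖τ (algebraMap (𝓞 E) E (MvPowerSeries.coeff n g))‖ *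
          Real.exp (-η) ^ Finsupp.applyAddHom (M := ℕ) () n ≤ B) ∧
      (∀ (D j : ℕ) (i : ↥(J (bw D j))), j < D → ∀ τ : E →+* ℂ,
        Summable (fun n : Unit →₀ ℕ ↦ ‖τ (algebraMap (𝓞 E) E (MvPowerSeries.coeff n
          (PowerSeries.map (Int.castRingHom (𝓞 E)) (Pf (bw D j) i.1 i.2) : MvPowerSeries Unit (𝓞 E))))‖ *
            Real.exp (-η) ^ Finsupp.applyAddHom (M := ℕ) () n) ∧
        ∑' n : Unit →₀ ℕ, ‖τ (algebraMap (𝓞 E) E (MvPowerSeries.coeff n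
          (PowerSeries.map (Int.castRingHom (𝓞 E)) (Pf (bw D j) i.1 i.2) : MvPowerSeries Unit (𝓞 E))))‖ *
            Real.exp (-η) ^ Finsupp.applyAddHom (M := ℕ) () n ≤ B ^ D) := by
    intro η hη
    obtain ⟨t₀, ht₀_def⟩ : ∃ t₀ : ℝ, t₀ = Real.exp (-η) := ⟨_, rfl⟩
    have ht₀0 : 0 < t₀ := by rw [ht₀_def]; exact Real.exp_pos _
    have ht₀1 : t₀ < 1 := by rw [ht₀_def, Real.exp_lt_one_iff]; linarith
    rw [← ht₀_def]
    -- sizes of `E₄`, `E₆`, `Δ`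
    obtain ⟨B₀, hB₀_def⟩ : ∃ B₀ : ℝ, B₀ = max 1 (max
        (∑' n : ℕ, ‖PowerSeries.coeff n (UpperHalfPlane.qExpansion 1 ⇑ModularForm.E₄)‖ * t₀ ^ n) (max
        (∑' n : ℕ, ‖PowerSeries.coeff n (UpperHalfPlane.qExpansion 1 ⇑ModularForm.E₆)‖ * t₀ ^ n)
        (∑' n : ℕ, ‖PowerSeries.coeff n (UpperHalfPlane.qExpansion 1 ⇑CuspForm.discriminant)‖ * t₀ ^ n))) :=
      ⟨_, rfl⟩
    have hB₀1 : 1 ≤ B₀ := by rw [hB₀_def]; exact le_max_left _ _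
    have hW₄B : ∑' n : ℕ, ‖PowerSeries.coeff n (UpperHalfPlane.qExpansion 1 ⇑ModularForm.E₄)‖ * t₀ ^ n ≤
        B₀ := by
      rw [hB₀_def]; exact (le_max_left _ _).trans (le_max_right _ _)
    have hW₆B : ∑' n : ℕ, ‖PowerSeries.coeff n (UpperHalfPlane.qExpansion 1 ⇑ModularForm.E₆)‖ * t₀ ^ n ≤
        B₀ := by
      rw [hB₀_def]; exact ((le_max_left _ _).trans (le_max_right _ _)).trans (le_max_right _ _)
    have hWΔB : ∑' n : ℕ, ‖PowerSeries.coeff n (UpperHalfPlane.qExpansion 1 ⇑CuspForm.discriminant)‖ *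
        t₀ ^ n ≤ B₀ := by
      rw [hB₀_def]; exact ((le_max_right _ _).trans (le_max_right _ _)).trans (le_max_right _ _)
    have hB₀u : 1 ≤ B₀ ^ (13 * u) := one_le_pow₀ hB₀1
    -- sizes of the conjugates of `g`
    have hSg : ∀ τ : E →+* ℂ, Summable fun n : ℕ ↦ ‖τ (a n)‖ * t₀ ^ n :=
      fun τ ↦ algMain_summable_of_radius (fun n ↦ τ (a n)) (harch τ) t₀ ht₀0.le ht₀1
    obtain ⟨Bg, hBg_def⟩ : ∃ Bg : ℝ, Bg = 1 + ∑ τ : E →+* ℂ, ∑' n : ℕ, ‖τ (a n)‖ * t₀ ^ n := ⟨_, rfl⟩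
    have hnn : ∀ τ : E →+* ℂ, 0 ≤ ∑' n : ℕ, ‖τ (a n)‖ * t₀ ^ n :=
      fun τ ↦ tsum_nonneg fun n ↦ mul_nonneg (norm_nonneg _) (pow_nonneg ht₀0.le _)
    have hWgB : ∀ τ : E →+* ℂ, ∑' n : ℕ, ‖τ (a n)‖ * t₀ ^ n ≤ Bg := by
      intro τ
      rw [hBg_def]
      have := Finset.single_le_sum (fun τ _ ↦ hnn τ) (Finset.mem_univ τ)
      linarith
    have hBg1 : 1 ≤ Bg := by
      rw [hBg_def]
      have := Finset.sum_nonneg fun τ (_ : τ ∈ (Finset.univ : Finset (E →+* ℂ))) ↦ hnn τ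
      linarith
    refine ⟨B₀ ^ (13 * u) * Bg, one_le_mul_of_one_le_of_one_le hB₀u hBg1, fun τ ↦ ?_,
      fun D j i hjD τ ↦ ?_⟩
    · have hF : ∀ ν : Unit →₀ ℕ, ‖τ (algebraMap (𝓞 E) E (MvPowerSeries.coeff ν g))‖ *
          t₀ ^ (Finsupp.applyAddHom (M := ℕ) () ν) = ‖τ (a (ν ()))‖ * t₀ ^ (ν ()) := fun ν ↦ by
        rw [hgcoeff, Finsupp.applyAddHom_apply]
      obtain ⟨hS, hT⟩ := engineQ_transport (fun m ↦ ‖τ (a m)‖ * t₀ ^ m) (hSg τ)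
      refine ⟨hS.congr fun ν ↦ (hF ν).symm, ?_⟩
      rw [tsum_congr hF, hT]
      exact (hWgB τ).trans (le_mul_of_one_le_left (zero_le_one.trans hBg1) hB₀u)
    · have hF : ∀ ν : Unit →₀ ℕ, ‖τ (algebraMap (𝓞 E) E (MvPowerSeries.coeff ν
          (PowerSeries.map (Int.castRingHom (𝓞 E)) (Pf (bw D j) i.1 i.2) : MvPowerSeries Unit (𝓞 E))))‖ *
            t₀ ^ (Finsupp.applyAddHom (M := ℕ) () ν) =
          ‖PowerSeries.coeff (ν ()) (UpperHalfPlane.qExpansion 1 ⇑(Ff (bw D j) i.1 i.2))‖ * t₀ ^ (ν ()) :=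
        fun ν ↦ by rw [hfcoeff, Finsupp.applyAddHom_apply]
      obtain ⟨hS, hT⟩ := engineQ_transport
        (fun m ↦ ‖PowerSeries.coeff m (UpperHalfPlane.qExpansion 1 ⇑(Ff (bw D j) i.1 i.2))‖ * t₀ ^ m)
        (algMain_summable_qExpansion (Ff (bw D j) i.1 i.2) t₀ ht₀0.le ht₀1)
      refine ⟨hS.congr fun ν ↦ (hF ν).symm, ?_⟩
      rw [tsum_congr hF, hT, hFprod]
      have hαβi : αf _ _ i.2 + βf _ _ i.2 + (i : ℕ) ≤ 13 * u * D := by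
        have h1 := hαβ _ _ i.2
        have h2 := hbw_le D j hjD.le
        omega
      calc _ ≤ B₀ ^ (13 * u * D) := engineQ_arch t₀ ht₀0 ht₀1 B₀ hB₀1 hW₄B hW₆B hWΔB _ _ _ _ hαβi
        _ = (B₀ ^ (13 * u)) ^ D := pow_mul B₀ (13 * u) D
        _ ≤ (B₀ ^ (13 * u) * Bg) ^ D :=
            pow_le_pow_left₀ (zero_le_one.trans hB₀u)
              (le_mul_of_one_le_right (zero_le_one.trans hB₀u) hBg1) D
  /- ### 6. The engine -/
  obtain ⟨D, P, hP0, hrel⟩ := stub_abstractEngineMain p E v Unit (Finsupp.applyAddHom ()) hfin ℤ V hV1 hV0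
    hVadd hVsmul hVmul (fun b ↦ ((12 + b) * (μ : ℤ)).toNat / 12) hSturmV
    (PowerSeries.map ι.symm.toRingHom
      (UpperHalfPlane.qExpansion 1 ⇑(ModularForm.E (show 3 ≤ p - 1 by omega))))
    ((p - 1 : ℕ) : ℤ) he0 heint heV g k (fun i ↦ PowerSeries.map ι.symm.toRingHom (c i)) haKV
    ((p : ℝ) ^ (-r)) (max 1 C) hρ0 hρ1 hC0 haK (fun n ↦ by rw [hgK]; exact hGK n)
    ((12 * u : ℕ) : ℤ) (((12 * u : ℕ) : ℝ) * μ / 12) (((p - 1 : ℕ) : ℝ) * μ / 12) μ hct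
    (fun D M ↦ engineQ_line μ (12 * u) (p - 1) D M) (fun D j ↦ ↥(J (bw D j)))
    (fun D j i ↦ PowerSeries.map (Int.castRingHom (𝓞 E)) (Pf (bw D j) i.1 i.2)) hfV harch' N₀ hcount
    hgrowth (24 * u) hQ
  /- ### 7. The classical relation -/
  have hrelC : ∑ uu : (jj : Fin D) × ↥(J (bw D jj)), σ₀ ((P uu : 𝓞 E) : E) •
      ((Pf (bw D uu.1) uu.2.1 uu.2.2).map (Int.castRingHom ℂ) *
        (PowerSeries.mk fun n ↦ σ₀ (a n)) ^ (uu.1 : ℕ)) = 0 := by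
    have h := congrArg (MvPowerSeries.map (σ := Unit) (σ₀.comp (algebraMap (𝓞 E) E))) hrel
    rw [map_zero, map_sum] at h
    rw [← h]
    refine Finset.sum_congr rfl fun uu _ ↦ ?_
    symm
    rw [MvPowerSeries.smul_eq_C_mul, map_mul, MvPowerSeries.map_C, map_mul, map_pow, hPfmap,
      hgmap σ₀ (fun n ↦ σ₀ (a n)) (fun n ↦ rfl), PowerSeries.smul_eq_C_mul]
    rfl
  exact stub_conclude k u D E σ₀ a J (bw D) (fun jj h ↦ hbw_cast D jj h) Ff Pf hFP hPlt hPi P hP0 hrelC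

end Summit.Langlands.Langlands.Theorems.HilbertIntegralOverconvergentIsCongruence

end
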